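import Summits.QuantumFields.BalabanUV.T4Continuum.Support.NE7ApexFrozenDefs
import Summits.QuantumFields.BalabanUV.T4Continuum.Support.NE7ApexFrozenScheme
import HarnessLib

/-!
# NE7ApexFrozenWitness — THE WITNESS: `Missing.HasContinuumLimit` AND `T4ApexVariance.StringwiseMatching` hold, with NO hypothesis, for the
# `Z2` plaquette scheme on the `d = 4` tori at the frozen couplings `β_K = n_K + K` (theorems only)

HONEST FRAMING (page 1).  Cell `pub-balaban`, rung (B)+1 sub-cell t4, lineage `b2b-balaban-t4-ne7-p1`, generation 31 (CRUX PROVER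
NE7 #1, ruling e34b3e0c (2)); skeleton `t4/skeletons/NE7-CRUX-R1.md` v1.7.10.  FIXED FINITE T⁴; continuum `SU(N)` Yang–Mills on T⁴ ⇐
BetaPertH ∧ nine spine estimates (0∕9 proved); BetaPertH ⇐ (D1) ∧ (D4) ∧ CAP+tail; G-an2-4 gates asym, D1 and NE2∕3∕4; NOT infinite
volume, NOT mass gap, NOT Clay.  The crux NE7 (node U5 = `T4ApexVariance.StringwiseMatching` for Bałaban's scheme) and the apex U0
(`Missing.HasContinuumLimit`) are NOT PRINTED and NOT PROVED, and NOTHING below bears on them: this is [our toy] — an HONEST lattice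
gauge theory (Wilson's action, product Haar measure, gauge-invariant observables of `Setup` ∕ `Missing`) in the one regime where an
elementary estimate decides everything, a FINITE gauge group at FROZEN couplings.  Its value: every inhabitant of the two apex
predicates this owner could find in the tree (gen 31 search of the `HasContinuumLimit` ∕ `StringwiseMatching` conclusions:
`T4VarianceMatching`, `T4PathMeanHybrid`, `NE7Pairwise*`, `NE7LawLevel*`, `CovariantMean*`, …) is CONDITIONAL on a rate hypothesis, and
the only unconditional statement about a concrete lattice gauge theory is compactness (`WilsonLoopLimit`: "nothing about the
dynamics of the lattice theory is used anywhere"); the four modules `NE7ApexFrozenPeierls` ∕ `NE7ApexFrozenScheme` (theorems, any finite group) and `NE7ApexFrozenDefs` ∕ `NE7ApexFrozenWitness` (the `Z2` plaquette instance)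
inhabit BOTH predicates OUTRIGHT by a Peierls-type energy–entropy bound under the Gibbs measure — a NON-VACUITY WITNESS of the apex
SHAPES by a lattice gauge theory and a calibration family for apex-level sockets.  The regime is DEGENERATE (no asymptotic freedom;
the limit theory is the trivial flat sector, every string expectation tends to `1`); NOT `SU(N)`, NOT Bałaban's renormalisation
group, NOT NE7, NOT summit progress.

THE MATHEMATICS OF THIS MODULE ([folklore]).  Plaquette variables are `1` on the flat sector (`plaquetteScheme_flat`, any gauge group);
`2^{n}e^{−2(n+K)} = (2e^{−2})^{n}(e^{−2})^{K} ≤ (e^{−2})^{K}` (`two_pow_mul_exp_le`), so the frozen rate `|Z2|^{n_K}e^{−2β_K}` of the `Z2` plaquette scheme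
at `β_K = n_K + K` is majorised by the summable `(e^{−2})^{K}` (`majorant_plaquetteScheme_Z2`, `summable_exp_neg_two_pow`); hence, by
`NE7ApexFrozenScheme.apex_of_summable_majorant` with `Δ = 2` (`NE7ApexFrozenDefs.Z2.gap`):
**`frozen_Z2_plaquette_apex : HasContinuumLimit S ∧ StringwiseMatching S` for `S = plaquetteScheme Z2 L hL m (frozenBeta L hL m) pl`, EVERY
odd `L > 1`, `m`, label type `O` and plaquette choice `pl` — NO hypothesis** — and `frozen_Z2_plaquette_tendsto_one` (every joint
expectation of plaquette variables tends to `1`).  No definition.  NOT `SU(N)`; NOT Bałaban's averaged observables; NOT NE7.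
-/

set_option autoImplicit false

noncomputable section

open MeasureTheory Filter Topology ProbabilityTheory
open scoped BigOperators ENNReal

namespace Summit.QuantumFields.BalabanUV.T4Continuum.NE7ApexFrozenWitness

open Literature.MathematicalPhysics.QuantumFieldTheory.Balaban1983to89
open Missing (boltzmann partitionFn expect TorusScheme HasContinuumLimit params4)
open NE7ApexFrozenDefs NE7ApexFrozenPeierls NE7ApexFrozenScheme

/-! ## §1 The `Z2` plaquette scheme at frozen couplings: both apex predicates, no hypothesis -/

section Plaquette

variable {G : Type*} [GaugeGroup G]

/-- Plaquette variables equal `1` on the flat sector (any gauge group). [folklore] -/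
theorem plaquetteScheme_flat (L : ℕ) (hL : Odd L ∧ 1 < L) (m : ℕ) (β : ℕ → ℝ) {O : Type*}
    (pl : (K : ℕ) → O → Plaq (params4 L hL m K) 0) (K : ℕ) (o : O) (U : GaugeField (params4 L hL m K) 0 G)
    (hU : wilsonAction4 U = 0) : (plaquetteScheme G L hL m β pl).obs K o U = 1 :=
  reTr_plaqHol_eq_one_of_action_zero hU (pl K o)

/-- `2·e^{−2} ≤ 1`. [folklore] -/
theorem two_mul_exp_neg_two_le_one : 2 * Real.exp (-2) ≤ 1 := by
  have h := Real.add_one_le_exp (2 : ℝ)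
  have hpos := Real.exp_pos (2 : ℝ)
  rw [Real.exp_neg, mul_inv_le_iff₀ hpos]
  linarith

/-- `e^{−2} < 1`. [folklore] -/
theorem exp_neg_two_lt_one : Real.exp (-2) < 1 := by
  rw [← Real.exp_zero]
  exact Real.exp_lt_exp.mpr (by norm_num)

/-- The arithmetic of the frozen rate: `2^{n}·e^{−2(n+K)} = (2e^{−2})^{n}·(e^{−2})^{K} ≤ (e^{−2})^{K}`. [folklore] -/
theorem two_pow_mul_exp_le (n K : ℕ) : (2 : ℝ) ^ n * Real.exp (-(2 * ((n : ℝ) + K))) ≤ Real.exp (-2) ^ K := by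
  have hsplit : Real.exp (-(2 * ((n : ℝ) + K))) = Real.exp (-2) ^ n * Real.exp (-2) ^ K := by
    rw [← Real.exp_nat_mul, ← Real.exp_nat_mul, ← Real.exp_add]
    congr 1
    ring
  rw [hsplit, ← mul_assoc, ← mul_pow]
  have h1 : (2 * Real.exp (-2)) ^ n ≤ 1 := pow_le_one₀ (by positivity) two_mul_exp_neg_two_le_one
  calc (2 * Real.exp (-2)) ^ n * Real.exp (-2) ^ K ≤ 1 * Real.exp (-2) ^ K := by gcongr
    _ = Real.exp (-2) ^ K := one_mul _

/-- **The frozen rate of the `Z2` plaquette scheme at `β_K = n_K + K` is majorised by `(e^{−2})^{K}`** — the hypothesis `hr` of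
`NE7ApexFrozenScheme` for this scheme, with `Δ = 2`. [folklore] -/
theorem majorant_plaquetteScheme_Z2 (L : ℕ) (hL : Odd L ∧ 1 < L) (m : ℕ) {O : Type*}
    (pl : (K : ℕ) → O → Plaq (params4 L hL m K) 0) (K : ℕ) :
    (Fintype.card Z2 : ℝ) ^ Fintype.card (PBond ((plaquetteScheme Z2 L hL m (frozenBeta L hL m) pl).P K) 0) *
        Real.exp (-(2 * (plaquetteScheme Z2 L hL m (frozenBeta L hL m) pl).β K)) ≤ Real.exp (-2) ^ K := by
  rw [Z2.card_eq, Nat.cast_ofNat]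
  exact two_pow_mul_exp_le (Fintype.card (PBond (params4 L hL m K) 0)) K

/-- The geometric majorant is summable. [folklore] -/
theorem summable_exp_neg_two_pow : Summable fun K : ℕ => Real.exp (-2) ^ K :=
  summable_geometric_of_lt_one (Real.exp_pos _).le exp_neg_two_lt_one

/-- **THE WITNESS.  For the `Z2` plaquette scheme on the `d = 4` tori `params4 L m K` at the frozen couplings `β_K = n_K + K`,
BOTH apex predicates of the T⁴ spine hold with no hypothesis: `Missing.HasContinuumLimit` (node U0: every joint expectation of
plaquette variables converges — to `1`) and `T4ApexVariance.StringwiseMatching` (node U5: matching modulo constants with summable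
remainder, radius `1`, volume factor `8e²`, `δ_K = e^{−2K} + e^{−2(K+1)}`).**  An honest lattice gauge theory (Wilson action, product
Haar measure, gauge-invariant observables) in a degenerate regime; [our toy]; NOT `SU(N)`, NOT NE7. [folklore] -/
theorem frozen_Z2_plaquette_apex (L : ℕ) (hL : Odd L ∧ 1 < L) (m : ℕ) {O : Type*}
    (pl : (K : ℕ) → O → Plaq (params4 L hL m K) 0) :
    HasContinuumLimit (plaquetteScheme Z2 L hL m (frozenBeta L hL m) pl) ∧
      T4ApexVariance.StringwiseMatching (plaquetteScheme Z2 L hL m (frozenBeta L hL m) pl) :=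
  apex_of_summable_majorant (plaquetteScheme Z2 L hL m (frozenBeta L hL m) pl)
    (plaquetteScheme_beta_nonneg L hL m (frozenBeta_nonneg L hL m) pl) Z2.gap
    (plaquetteScheme_abs_le L hL m _ pl) (plaquetteScheme_flat L hL m _ pl) (majorant_plaquetteScheme_Z2 L hL m pl)
    summable_exp_neg_two_pow

/-- The limit identified: every joint expectation of plaquette variables tends to `1`. [folklore] -/
theorem frozen_Z2_plaquette_tendsto_one (L : ℕ) (hL : Odd L ∧ 1 < L) (m : ℕ) {O : Type*}
    (pl : (K : ℕ) → O → Plaq (params4 L hL m K) 0) (os : List O) :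
    Tendsto (fun K => (plaquetteScheme Z2 L hL m (frozenBeta L hL m) pl).expectAt K os) atTop (𝓝 1) :=
  tendsto_expectAt_one (plaquetteScheme Z2 L hL m (frozenBeta L hL m) pl)
    (plaquetteScheme_beta_nonneg L hL m (frozenBeta_nonneg L hL m) pl) Z2.gap
    (plaquetteScheme_abs_le L hL m _ pl) (plaquetteScheme_flat L hL m _ pl) (majorant_plaquetteScheme_Z2 L hL m pl)
    summable_exp_neg_two_pow.tendsto_atTop_zero os


/-- … hence the limit points of every joint expectation are UNIQUE along any two subsequences of spacings (the toy settles, for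
itself, the «not necessarily unique» of [MagnenRivasseauSeneor1993] p. 326 recorded at `Missing.HasUniqueLimitPoints`). [folklore] -/
theorem frozen_Z2_plaquette_uniqueLimitPoints (L : ℕ) (hL : Odd L ∧ 1 < L) (m : ℕ) {O : Type*}
    (pl : (K : ℕ) → O → Plaq (params4 L hL m K) 0) :
    Missing.HasUniqueLimitPoints (plaquetteScheme Z2 L hL m (frozenBeta L hL m) pl) :=
  T4Assembly.hasUniqueLimitPoints_of_hasContinuumLimit _ (frozen_Z2_plaquette_apex L hL m pl).1

end Plaquette

end Summit.QuantumFields.BalabanUV.T4Continuum.NE7ApexFrozenWitness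

end
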